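import Literature.NumberTheory.EllipticCurves.EtaOcticLevelNine
import Literature.NumberTheory.EllipticCurves.ModularFunctionFieldPointValues
import HarnessLib

/-!
# Weber's `γ₂(3τ) = E₄(3τ)/η(3τ)⁸` as an element of the function field `K_9 = ℂ(X₀(9))`
# (Cox, *Primes of the form x² + ny²*, Prop. 12.3)

Topic `NumberTheory/EllipticCurves` (modular functions of level `Γ₀(9)` / complex multiplication),
namespace `Literature.NumberTheory.EllipticCurves.ModularForms`.  Definitions with bodies, all
statements proved, no named fact.

> Cox, Prop. 12.3: "`γ₂(3τ)` is a modular function for the group `Γ₀(9)`."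

In the tree's language the modular functions of level `Γ₀(N)` are the elements of
`modularFunctionField N ⊂ ℂ((q))` — `q`-expansions of quotients `F/G` of modular forms of equal
weight for `Γ₀(N)` (`ModularFunctionField.lean`, `mkFn`).  With `η(3τ)⁸ ∈ S₄(Γ₀(9))`
(`EtaOcticLevelNine.lean`) and `E₄(3τ), Δ(3τ)` (the tree's `scaleN`, restricted from `Γ₀(3)` by
`ofLevelLe`):

* `E₄ThreeNine`, `deltaThreeNine`, `weberNineNum = E₄(3τ)η(3τ)¹⁶`, `E₄ThreeNineCube = E₄(3τ)³`
  (forms of weight `4, 12, 12, 12` for `Γ₀(9)`);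
* `weberNineFn = E₄(3τ)η(3τ)¹⁶/Δ(3τ) ∈ K_9` — **Weber's `γ₂(3τ) = E₄(3τ)/η(3τ)⁸` as a modular
  function of level `9`** — and `kleinJThreeNineFn = E₄(3τ)³/Δ(3τ) = j(3τ) ∈ K_9`;
* `pointValuation_weberNineFn_sub_lt_one` — `γ₂(3τ)` is regular at every `τ ∈ ℍ` with value
  `E₄(3τ)/η(3τ)⁸` (`Δ(3τ) ≠ 0`); `pointValuation_kleinJThreeNineFn_sub_lt_one` likewise;
* `weberNineFn_pow_three` — **`γ₂(3τ)³ = j(3τ)` in `K_9`**.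

Sequel: the `q`-series of `γ₂(3τ)` is fixed by `Aut(ℂ)` (`WeberGamma2LevelNineRational.lean`), so
that its values at level-`9` CM points are transported along `Aut(ℂ)`
(`ModularFunctionValueTransport.lean`) — the route to Cox's Thm. 12.2 (`γ₂(τ₀) ∈ K(j(τ₀))`) for the
complex-multiplication input of `Literature.Barriers.ABC.OWeakUniformABCImpliesNoSiegelZeros`.

## References

* D. A. Cox, *Primes of the form x² + ny²*, 2nd ed., 2013, §12.A Prop. 12.3, (12.5). [Cox2013]
* F. Diamond, J. Shurman, *A First Course in Modular Forms*, GTM 228, 2005, §7.5 (`ℂ(X(Γ))`).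
  [DiamondShurman2005]
-/

noncomputable section

open UpperHalfPlane hiding I
open Complex ModularForm CongruenceSubgroup Matrix.SpecialLinearGroup EisensteinSeries
open scoped MatrixGroups Real ModularForm Manifold

namespace Literature.NumberTheory.EllipticCurves.ModularForms

/-! ### The level-`9` forms `E₄(3τ)`, `Δ(3τ)`, `E₄(3τ)η(3τ)¹⁶`, `E₄(3τ)³` -/

/-- `E₄(3τ)` as a modular form of weight `4` for `Γ₀(9)` (`V₃ E₄` restricted from `Γ₀(3)`). [folklore] -/
def E₄ThreeNine : ModularForm (Gamma0 9) 4 :=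
  ofLevelLe Gamma0_nine_le_three (scaleN 3 E₄)

/-- `E₄ThreeNine τ = E₄(3τ)`. [folklore] -/
@[simp] theorem E₄ThreeNine_apply (τ : ℍ) : E₄ThreeNine τ = E₄ (tpD 3 • τ) := rfl

/-- `Δ(3τ)` as a modular form of weight `12` for `Γ₀(9)`. [folklore] -/
def deltaThreeNine : ModularForm (Gamma0 9) 12 :=
  ofLevelLe Gamma0_nine_le_three (scaleN 3 delta)

/-- `deltaThreeNine τ = Δ(3τ)`. [folklore] -/
@[simp] theorem deltaThreeNine_apply (τ : ℍ) :
    deltaThreeNine τ = ModularForm.discriminant (tpD 3 • τ) := rfl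

/-- `Δ(3τ) = η(3τ)²⁴`. [folklore] -/
theorem deltaThreeNine_apply_eq_eta_pow (τ : ℍ) :
    deltaThreeNine τ = η (3 * (τ : ℂ)) ^ 24 := by
  rw [deltaThreeNine_apply, ModularForm.discriminant, coe_tpD_smul]
  push_cast
  ring_nf

/-- `Δ(3τ) ≠ 0` pointwise. [folklore] -/
theorem deltaThreeNine_apply_ne_zero (τ : ℍ) : deltaThreeNine τ ≠ 0 := by
  rw [deltaThreeNine_apply]
  exact ModularForm.discriminant_ne_zero _

/-- `Δ(3τ) ≠ 0` as a form. [folklore] -/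
theorem deltaThreeNine_ne_zero : deltaThreeNine ≠ 0 := fun h ↦ by
  have := congrArg (fun f : ModularForm (Gamma0 9) 12 ↦ f UpperHalfPlane.I) h
  exact deltaThreeNine_apply_ne_zero _ (by simpa using this)

/-- The numerator `E₄(3τ)·η(3τ)¹⁶` of weight `12`. [folklore] -/
def weberNineNum : ModularForm (Gamma0 9) 12 :=
  ((E₄ThreeNine.mul etaOcticNineForm).mul etaOcticNineForm).mcast (by norm_num)

/-- The underlying function of `weberNineNum` is the product `E₄(3τ) · η(3τ)⁸ · η(3τ)⁸`. [folklore] -/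
theorem coe_weberNineNum :
    (⇑weberNineNum : ℍ → ℂ) = ⇑E₄ThreeNine * ⇑etaOcticNineForm * ⇑etaOcticNineForm := rfl

/-- `weberNineNum τ = E₄(3τ) η(3τ)¹⁶`. [folklore] -/
@[simp] theorem weberNineNum_apply (τ : ℍ) :
    weberNineNum τ = E₄ (tpD 3 • τ) * η (3 * (τ : ℂ)) ^ 16 := by
  rw [show weberNineNum τ = (⇑weberNineNum : ℍ → ℂ) τ from rfl, coe_weberNineNum]
  simp only [Pi.mul_apply, E₄ThreeNine_apply, etaOcticNineForm_apply]
  ring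

/-- The numerator `E₄(3τ)³` of `j(3τ)`, of weight `12`. [folklore] -/
def E₄ThreeNineCube : ModularForm (Gamma0 9) 12 :=
  ((E₄ThreeNine.mul E₄ThreeNine).mul E₄ThreeNine).mcast (by norm_num)

/-- The underlying function of `E₄ThreeNineCube` is `E₄(3τ) · E₄(3τ) · E₄(3τ)`. [folklore] -/
theorem coe_E₄ThreeNineCube :
    (⇑E₄ThreeNineCube : ℍ → ℂ) = ⇑E₄ThreeNine * ⇑E₄ThreeNine * ⇑E₄ThreeNine := rfl

/-- `E₄ThreeNineCube τ = E₄(3τ)³`. [folklore] -/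
@[simp] theorem E₄ThreeNineCube_apply (τ : ℍ) : E₄ThreeNineCube τ = E₄ (tpD 3 • τ) ^ 3 := by
  rw [show E₄ThreeNineCube τ = (⇑E₄ThreeNineCube : ℍ → ℂ) τ from rfl, coe_E₄ThreeNineCube]
  simp only [Pi.mul_apply, E₄ThreeNine_apply]
  ring

/-! ### The elements `u₉ = γ₂(3τ)` and `j(3τ)` of `K_9` -/

/-- **Weber's `γ₂(3τ)` as an element of `K_9 = ℂ(X₀(9))`**: the class of
`E₄(3τ)η(3τ)¹⁶ / Δ(3τ) = E₄(3τ)/η(3τ)⁸` (Cox, Prop. 12.3: "`γ₂(3τ)` is a modular function for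
`Γ₀(9)`"). [cite: Cox2013, §12.A Prop. 12.3] -/
def weberNineFn : modularFunctionField 9 :=
  mkFn weberNineNum deltaThreeNine deltaThreeNine_ne_zero

/-- **`j(3τ)` as an element of `K_9`**: the class of `E₄(3τ)³/Δ(3τ)`. [cite: Cox2013, §11.B Thm. 11.9] -/
def kleinJThreeNineFn : modularFunctionField 9 :=
  mkFn E₄ThreeNineCube deltaThreeNine deltaThreeNine_ne_zero

/-- **The value of `u₉` at `τ` is `E₄(3τ)/η(3τ)⁸ = γ₂(3τ)`**: `v_τ(u₉ − γ₂(3τ)) < 1`, at every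
point of `ℍ` (`u₉` is holomorphic on `ℍ` since `Δ(3τ) ≠ 0`). [cite: Cox2013, §12.A Prop. 12.3] -/
theorem pointValuation_weberNineFn_sub_lt_one (τ : ℍ) :
    pointValuation (N := 9) τ (weberNineFn - algebraMap ℂ (modularFunctionField 9)
      (E₄ (tpD 3 • τ) / η (3 * (τ : ℂ)) ^ 8)) < 1 := by
  apply pointValuation_mkFn_sub_lt_one_of_orderAt_lt
  set c : ℂ := E₄ (tpD 3 • τ) / η (3 * (τ : ℂ)) ^ 8 with hc
  set G : ModularForm (Gamma0 9) 12 := weberNineNum - c • deltaThreeNine with hG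
  by_cases hG0 : G = 0
  · exact Or.inl hG0
  · right
    have hη : η (3 * (τ : ℂ)) ≠ 0 := ModularForm.eta_ne_zero (by simpa using mul_pos (by norm_num : (0:ℝ) < 3) τ.2)
    have hGτ : G τ = 0 := by
      have h1 : G τ = weberNineNum τ - c * deltaThreeNine τ := by
        simp [hG, sub_eq_add_neg]
      rw [h1, weberNineNum_apply, deltaThreeNine_apply_eq_eta_pow, hc]
      field_simp
      ring
    rw [(orderAt_eq_zero_iff deltaThreeNine_ne_zero τ).mpr (deltaThreeNine_apply_ne_zero τ)]
    exact Nat.pos_of_ne_zero fun h0 ↦ (orderAt_eq_zero_iff hG0 τ).mp h0 hGτ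

/-- **The value of `j(3τ) ∈ K_9` at `τ` is `j(3τ) = E₄(3τ)³/Δ(3τ)`.** [folklore] -/
theorem pointValuation_kleinJThreeNineFn_sub_lt_one (τ : ℍ) :
    pointValuation (N := 9) τ (kleinJThreeNineFn - algebraMap ℂ (modularFunctionField 9)
      (E₄ (tpD 3 • τ) ^ 3 / ModularForm.discriminant (tpD 3 • τ))) < 1 := by
  apply pointValuation_mkFn_sub_lt_one_of_orderAt_lt
  set c : ℂ := E₄ (tpD 3 • τ) ^ 3 / ModularForm.discriminant (tpD 3 • τ) with hc
  set G : ModularForm (Gamma0 9) 12 := E₄ThreeNineCube - c • deltaThreeNine with hG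
  by_cases hG0 : G = 0
  · exact Or.inl hG0
  · right
    have hGτ : G τ = 0 := by
      have h1 : G τ = E₄ThreeNineCube τ - c * deltaThreeNine τ := by
        simp [hG, sub_eq_add_neg]
      rw [h1, E₄ThreeNineCube_apply, deltaThreeNine_apply, hc,
        div_mul_cancel₀ _ (ModularForm.discriminant_ne_zero _), sub_self]
    rw [(orderAt_eq_zero_iff deltaThreeNine_ne_zero τ).mpr (deltaThreeNine_apply_ne_zero τ)]
    exact Nat.pos_of_ne_zero fun h0 ↦ (orderAt_eq_zero_iff hG0 τ).mp h0 hGτ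

/-- The identity `(E₄(3τ)η¹⁶)³ · Δ(3τ)³ … `: as modular forms of weight `48`,
`weberNineNum³ · Δ₃ = E₄ThreeNineCube · Δ₃³` — pointwise `E₄³η⁴⁸·η²⁴ = E₄³·η⁷²`. [folklore] -/
theorem weberNineNum_cube_mul_delta :
    (((weberNineNum.mul weberNineNum).mul weberNineNum).mul deltaThreeNine :
        ModularForm (Gamma0 9) (12 + 12 + 12 + 12)) =
      ((E₄ThreeNineCube.mul deltaThreeNine).mul deltaThreeNine).mul deltaThreeNine := by
  apply DFunLike.ext
  intro τ
  simp only [ModularForm.coe_mul, Pi.mul_apply, weberNineNum_apply, E₄ThreeNineCube_apply,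
    deltaThreeNine_apply_eq_eta_pow]
  ring

/-- **`u₉³ = j(3τ)` in `K_9`** (`γ₂³ = j`). [cite: Cox2013, §12.A (`γ₂(τ)³ = j(τ)`)] -/
theorem weberNineFn_pow_three : weberNineFn ^ 3 = kleinJThreeNineFn := by
  apply Subtype.ext
  have hΔ : qExpansionL 9 deltaThreeNine ≠ 0 := (qExpansionL_eq_zero_iff 9 _).not.mpr deltaThreeNine_ne_zero
  change ((qExpansionL 9 weberNineNum / qExpansionL 9 deltaThreeNine) ^ 3 : LaurentSeries ℂ) =
    qExpansionL 9 E₄ThreeNineCube / qExpansionL 9 deltaThreeNine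
  have key : qExpansionL 9 weberNineNum ^ 3 * qExpansionL 9 deltaThreeNine =
      qExpansionL 9 E₄ThreeNineCube * qExpansionL 9 deltaThreeNine ^ 3 := by
    have h := congrArg (qExpansionL 9) weberNineNum_cube_mul_delta
    simp only [qExpansionL_mul] at h
    calc qExpansionL 9 weberNineNum ^ 3 * qExpansionL 9 deltaThreeNine
        = qExpansionL 9 weberNineNum * qExpansionL 9 weberNineNum * qExpansionL 9 weberNineNum *
            qExpansionL 9 deltaThreeNine := by ring
      _ = qExpansionL 9 E₄ThreeNineCube * qExpansionL 9 deltaThreeNine * qExpansionL 9 deltaThreeNine *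
            qExpansionL 9 deltaThreeNine := h
      _ = qExpansionL 9 E₄ThreeNineCube * qExpansionL 9 deltaThreeNine ^ 3 := by ring
  rw [div_pow, div_eq_div_iff (pow_ne_zero 3 hΔ) hΔ]
  exact key

end Literature.NumberTheory.EllipticCurves.ModularForms

end
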